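import Literature.MeasureTheory.Group.InvariantQuotientOrbitalPiProdNormalized
import HarnessLib

/-!
# Transport of product torus measures along a torus isomorphism that is a product over the factors
(Gelbart, *Automorphic forms on adele groups* (1975), §10, p. 155: the tori `B_𝔸 = B_S × B^S`,
`B'_𝔸 = B'_S × B'^S` of the two trace formulas are identified factor by factor, `B_v = B'_v`, `B^S = B'^S`,
and with them the Haar measures `db = Π_v db_v`)

Topic `MeasureTheory/Group`; namespace `Literature.MeasureTheory.Group`; small definitions with bodies
(`ContinuousMulEquiv.piCongrRight'`, `ContinuousMulEquiv.prodCongr'`, `subgroupPiContinuousMulEquiv`,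
`subgroupProdContinuousMulEquiv`, `subgroupPiCongr`, `subgroupProdCongr`, `tupleCentralizerEquivPi`,
`tupleCentralizerCongr` — congruences of products of (subgroup) topological groups and of tuple
centralisers) and theorems; no named fact, no instance visible to importers.

Setting. Two "product situations" as in `InvariantQuotientOrbitalPiProdNormalized`: bicontinuous
`e₁ : (Π_i G₁ᵢ) × G₁' ≃* G₁`, `e₂ : (Π_i G₂ᵢ) × G₂' ≃* G₂`, elements `γ₁ = e₁((γ₁ᵢ), γ₁')`,
`γ₂ = e₂((γ₂ᵢ), γ₂')` with closed centralisers, and on side `1` Haar measures on the tori in product form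
(`ρ₁ᵢ`, `ρ₁'`, `ρ₁p`, `ρ₁₁`, `ρ₁q`, `ρ₁` with the hypotheses `h₁p`, `h₁₁`, `h₁q`, `h₁`). The two
situations are NOT assumed isomorphic (the ambient groups `D_𝔸ˣ` and `GL₂(𝔸)` are not); only the
TORI are: `Pᵢ : C(γ₁ᵢ) ≃ₜ* C(γ₂ᵢ)`, `P' : C(γ₁') ≃ₜ* C(γ₂')`, `P : C(γ₁) ≃ₜ* C(γ₂)`, with `P` the product
of the `Pᵢ` and `P'` in the coordinates `e₁`, `e₂` (hypotheses `hPi`, `hP'` on components).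

* `isMulLeftInvariant_map_continuousMulEquiv`, `isFiniteMeasureOnCompacts_map_continuousMulEquiv`,
  `isOpenPosMeasure_map_continuousMulEquiv`, `isInvInvariant_map_continuousMulEquiv`,
  `sigmaFinite_map_continuousMulEquiv` — Haar-type properties pass to images under isomorphisms;
* `map_subgroupPiCoords_map_subgroupPiCongr`, `map_prodEquiv_map_subgroupProdCongr` — images of product
  measures under the congruences are products of the images;
* `torusMeasure_transport` — **the measures `ρ₂ᵢ = (Pᵢ)_* ρ₁ᵢ`, `ρ₂' = P'_* ρ₁'`, `ρ₂ = P_* ρ₁` are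
  again in product form** on side `2` (with the explicit `ρ₂p`, `ρ₂₁`, `ρ₂q`);
* `lintegral_descConj_quotientMeasure_eq_prod_mul_of_torusEquiv`,
  `integral_descConj_quotientMeasure_eq_prod_mul_of_torusEquiv` — **hence Gelbart's (10.19) with its
  equality sign holds on side `2` for the transported torus measures**:
  `∫_{G₂/C(γ₂)} Φ d(ν₂ / P_*ρ₁) = (Π_i ∫_{G₂ᵢ/C(γ₂ᵢ)} ξ_i d(ν₂ᵢ / (Pᵢ)_*ρ₁ᵢ)) ∫_{G₂'/C(γ₂')} Θ d(ν₂' / P'_*ρ₁')`.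

With `e₁ = Quat.placesSplitting`, `e₂ = GLn.placesSplitting`, `P = Ψ : C_{D_𝔸ˣ}(γ') ≅ C_{GL₂(𝔸)}(γ)`
(`quaternionGlTwoCentralizerAdelicEquiv`) and its factors `Ψ_v`, `Ψ^S`
(`QuaternionGLTwoLocalTori`, `QuaternionGLTwoAwayTori`) this is the bookkeeping by which ONE choice of
torus measures serves both sides of the comparison of (10.14) and (10.15). Part of the inline (D-0026)
decomposition of `Literature.NumberTheory.Automorphic.strong_multiplicity_one_quaternionUnits`.

## References

* S. Gelbart, *Automorphic forms on adele groups*, Ann. of Math. Studies 83 (1975), §10, p. 155,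
  (10.19) [Gelbart1975].
* G. B. Folland, *A Course in Abstract Harmonic Analysis* (1995), §2.6 [Folland1995].
-/

noncomputable section

open MeasureTheory MeasureTheory.Measure Topology
open scoped NNReal ENNReal

namespace Literature.MeasureTheory.Group

/-! ### Haar-type properties of images under isomorphisms of topological groups -/

section MapEquiv

variable {A B : Type*} [Group A] [Group B] [TopologicalSpace A] [TopologicalSpace B]
  [MeasurableSpace A] [MeasurableSpace B] [BorelSpace A] [BorelSpace B]

/-- The image of a left-invariant measure under an isomorphism of topological groups is left invariant.
[folklore] -/
theorem isMulLeftInvariant_map_continuousMulEquiv [IsTopologicalGroup A] [IsTopologicalGroup B]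
    (e : A ≃ₜ* B) (μ : Measure A) [μ.IsMulLeftInvariant] : (Measure.map e μ).IsMulLeftInvariant :=
  isMulLeftInvariant_map (μ := μ) e.toMulEquiv.toMulHom e.continuous.measurable e.surjective

/-- The image of a measure finite on compact sets under an isomorphism of topological groups is finite on
compact sets. [folklore] -/
theorem isFiniteMeasureOnCompacts_map_continuousMulEquiv (e : A ≃ₜ* B) (μ : Measure A) [IsFiniteMeasureOnCompacts μ] :
    IsFiniteMeasureOnCompacts (Measure.map e μ) :=
  IsFiniteMeasureOnCompacts.map μ e.toHomeomorph

/-- The image of a measure positive on open sets under an isomorphism of topological groups is positive on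
open sets. [folklore] -/
theorem isOpenPosMeasure_map_continuousMulEquiv (e : A ≃ₜ* B) (μ : Measure A) [μ.IsOpenPosMeasure] :
    (Measure.map e μ).IsOpenPosMeasure :=
  e.continuous.isOpenPosMeasure_map e.surjective

/-- The image of an inversion-invariant measure under an isomorphism of topological groups is inversion
invariant. [folklore] -/
theorem isInvInvariant_map_continuousMulEquiv [IsTopologicalGroup A] [IsTopologicalGroup B]
    (e : A ≃ₜ* B) (μ : Measure A) [μ.IsInvInvariant] : (Measure.map e μ).IsInvInvariant :=
  isInvInvariant_map_mulEquiv e.toMulEquiv e.continuous.measurable μ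

/-- The image of a σ-finite measure under an isomorphism of topological groups is σ-finite. [folklore] -/
theorem sigmaFinite_map_continuousMulEquiv (e : A ≃ₜ* B) (μ : Measure A) [SigmaFinite μ] :
    SigmaFinite (Measure.map e μ) :=
  e.toHomeomorph.toMeasurableEquiv.sigmaFinite_map

end MapEquiv

/-! ### Congruences of products of topological groups and of their subgroups -/

section Congr

variable {ι : Type*} {A B : ι → Type*} [∀ i, Group (A i)] [∀ i, Group (B i)] [∀ i, TopologicalSpace (A i)]
  [∀ i, TopologicalSpace (B i)]

/-- **`Π_i A_i ≃ₜ* Π_i B_i` from `A_i ≃ₜ* B_i`** (componentwise). [folklore] -/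
def ContinuousMulEquiv.piCongrRight' (P : ∀ i, A i ≃ₜ* B i) : (∀ i, A i) ≃ₜ* ∀ i, B i :=
  { MulEquiv.piCongrRight fun i => (P i).toMulEquiv with
    continuous_toFun := continuous_pi fun i => (P i).continuous.comp (continuous_apply i)
    continuous_invFun := continuous_pi fun i => (P i).symm.continuous.comp (continuous_apply i) }

/-- Components of `piCongrRight'` (definitional). [folklore] -/
@[simp]
theorem ContinuousMulEquiv.piCongrRight'_apply (P : ∀ i, A i ≃ₜ* B i) (a : ∀ i, A i) (i : ι) :
    ContinuousMulEquiv.piCongrRight' P a i = P i (a i) := rfl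

variable {A₀ B₀ A₀' B₀' : Type*} [Group A₀] [Group B₀] [Group A₀'] [Group B₀'] [TopologicalSpace A₀] [TopologicalSpace B₀]
  [TopologicalSpace A₀'] [TopologicalSpace B₀']

/-- **`A × A' ≃ₜ* B × B'` from `A ≃ₜ* B`, `A' ≃ₜ* B'`.** [folklore] -/
def ContinuousMulEquiv.prodCongr' (P : A₀ ≃ₜ* B₀) (Q : A₀' ≃ₜ* B₀') : A₀ × A₀' ≃ₜ* B₀ × B₀' :=
  { MulEquiv.prodCongr P.toMulEquiv Q.toMulEquiv with
    continuous_toFun := (P.continuous.comp continuous_fst).prodMk (Q.continuous.comp continuous_snd)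
    continuous_invFun := (P.symm.continuous.comp continuous_fst).prodMk (Q.symm.continuous.comp continuous_snd) }

/-- `prodCongr'` is `Prod.map` (definitional). [folklore] -/
@[simp]
theorem ContinuousMulEquiv.prodCongr'_apply (P : A₀ ≃ₜ* B₀) (Q : A₀' ≃ₜ* B₀') (p : A₀ × A₀') :
    ContinuousMulEquiv.prodCongr' P Q p = (P p.1, Q p.2) := rfl

end Congr

section SubgroupCongr

variable {ι : Type*} {G : ι → Type*} [∀ i, Group (G i)] [∀ i, TopologicalSpace (G i)] (H : ∀ i, Subgroup (G i))

/-- **`↥(Π_i H_i) ≃ₜ* Π_i ↥H_i`** as an isomorphism of topological groups (`subgroupPiCoords`, continuous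
both ways by `subgroupPiHomeomorph`). [folklore] -/
def subgroupPiContinuousMulEquiv : (Subgroup.pi Set.univ H) ≃ₜ* ∀ i, H i :=
  { subgroupPiCoords H with
    continuous_toFun := (subgroupPiHomeomorph H).continuous
    continuous_invFun := (subgroupPiHomeomorph H).symm.continuous }

/-- `subgroupPiContinuousMulEquiv = subgroupPiCoords` as functions (definitional). [folklore] -/
theorem subgroupPiContinuousMulEquiv_apply (h : Subgroup.pi Set.univ H) :
    subgroupPiContinuousMulEquiv H h = subgroupPiCoords H h := rfl

variable {H} {G₂ : ι → Type*} [∀ i, Group (G₂ i)] [∀ i, TopologicalSpace (G₂ i)] {H₂ : ∀ i, Subgroup (G₂ i)}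

/-- **`↥(Π_i H_i) ≃ₜ* ↥(Π_i H₂ᵢ)` from `↥H_i ≃ₜ* ↥H₂ᵢ`**: in coordinates the componentwise congruence.
[folklore] -/
def subgroupPiCongr (P : ∀ i, H i ≃ₜ* H₂ i) : (Subgroup.pi Set.univ H) ≃ₜ* (Subgroup.pi Set.univ H₂) :=
  ((subgroupPiContinuousMulEquiv H).trans (ContinuousMulEquiv.piCongrRight' P)).trans (subgroupPiContinuousMulEquiv H₂).symm

/-- Coordinates of `subgroupPiCongr P h` (definitional). [folklore] -/
@[simp]
theorem coe_subgroupPiCongr_apply (P : ∀ i, H i ≃ₜ* H₂ i) (h : Subgroup.pi Set.univ H) (i : ι) :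
    ((subgroupPiCongr P h : Subgroup.pi Set.univ H₂) : ∀ i, G₂ i) i = (P i (subgroupPiCoords H h i) : G₂ i) := rfl

/-- `coords (subgroupPiCongr P h) = (P_i (coords h)_i)_i`. [folklore] -/
theorem subgroupPiCoords_subgroupPiCongr (P : ∀ i, H i ≃ₜ* H₂ i) (h : Subgroup.pi Set.univ H) :
    subgroupPiCoords H₂ (subgroupPiCongr P h) = fun i => P i (subgroupPiCoords H h i) := rfl

variable {L L₂ M M₂ : Type*} [Group L] [Group L₂] [Group M] [Group M₂] [TopologicalSpace L] [TopologicalSpace L₂]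
  [TopologicalSpace M] [TopologicalSpace M₂] {HL : Subgroup L} {HL₂ : Subgroup L₂} {HM : Subgroup M} {HM₂ : Subgroup M₂}

variable (HL HM) in
/-- **`↥(H × K) ≃ₜ* ↥H × ↥K`** as an isomorphism of topological groups (Mathlib `Subgroup.prodEquiv`, which is
continuous both ways). [folklore] -/
def subgroupProdContinuousMulEquiv : (HL.prod HM) ≃ₜ* HL × HM :=
  { Subgroup.prodEquiv HL HM with
    continuous_toFun := ((continuous_fst.comp continuous_subtype_val).subtype_mk _).prodMk
      ((continuous_snd.comp continuous_subtype_val).subtype_mk _)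
    continuous_invFun := ((continuous_subtype_val.comp continuous_fst).prodMk
      (continuous_subtype_val.comp continuous_snd)).subtype_mk _ }

/-- `subgroupProdContinuousMulEquiv = Subgroup.prodEquiv` as functions (definitional). [folklore] -/
theorem subgroupProdContinuousMulEquiv_apply (h : HL.prod HM) :
    subgroupProdContinuousMulEquiv HL HM h = Subgroup.prodEquiv HL HM h := rfl

/-- **`↥(H × K) ≃ₜ* ↥(H₂ × K₂)` from `↥H ≃ₜ* ↥H₂`, `↥K ≃ₜ* ↥K₂`.** [folklore] -/
def subgroupProdCongr (P : HL ≃ₜ* HL₂) (Q : HM ≃ₜ* HM₂) : (HL.prod HM) ≃ₜ* (HL₂.prod HM₂) :=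
  ((subgroupProdContinuousMulEquiv HL HM).trans (ContinuousMulEquiv.prodCongr' P Q)).trans
    (subgroupProdContinuousMulEquiv HL₂ HM₂).symm

/-- `prodEquiv (subgroupProdCongr P Q h) = (P (prodEquiv h).1, Q (prodEquiv h).2)`. [folklore] -/
theorem prodEquiv_subgroupProdCongr (P : HL ≃ₜ* HL₂) (Q : HM ≃ₜ* HM₂) (h : HL.prod HM) :
    Subgroup.prodEquiv HL₂ HM₂ (subgroupProdCongr P Q h) = (P (Subgroup.prodEquiv HL HM h).1, Q (Subgroup.prodEquiv HL HM h).2) := rfl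

/-- Underlying element of `subgroupProdCongr P Q h` (definitional). [folklore] -/
theorem coe_subgroupProdCongr_apply (P : HL ≃ₜ* HL₂) (Q : HM ≃ₜ* HM₂) (h : HL.prod HM) :
    ((subgroupProdCongr P Q h : HL₂.prod HM₂) : L₂ × M₂) =
      ((P (Subgroup.prodEquiv HL HM h).1 : L₂), (Q (Subgroup.prodEquiv HL HM h).2 : M₂)) := rfl

end SubgroupCongr

/-! ### Images of product measures -/

section MapProd

variable {ι : Type*} [Fintype ι] {G : ι → Type*} [∀ i, Group (G i)] [∀ i, TopologicalSpace (G i)]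
  [∀ i, MeasurableSpace (G i)] [∀ i, BorelSpace (G i)] [∀ i, SecondCountableTopology (G i)]
  {H : ∀ i, Subgroup (G i)}
  {G₂ : ι → Type*} [∀ i, Group (G₂ i)] [∀ i, TopologicalSpace (G₂ i)] [∀ i, MeasurableSpace (G₂ i)]
  [∀ i, BorelSpace (G₂ i)] [∀ i, SecondCountableTopology (G₂ i)] {H₂ : ∀ i, Subgroup (G₂ i)}

/-- **The coordinates of the image of a product measure under `subgroupPiCongr P` are the product of the
images**: if `coords_* ρp = ⊗ ρ_i` then `coords_* ((subgroupPiCongr P)_* ρp) = ⊗ (P_i)_* ρ_i`. [folklore] -/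
theorem map_subgroupPiCoords_map_subgroupPiCongr (P : ∀ i, H i ≃ₜ* H₂ i) (ρi : ∀ i, Measure (H i))
    [∀ i, SigmaFinite (ρi i)] (ρp : Measure (Subgroup.pi Set.univ H))
    (hρp : Measure.map (subgroupPiCoords H) ρp = Measure.pi ρi) :
    Measure.map (subgroupPiCoords H₂) (Measure.map (subgroupPiCongr P) ρp) = Measure.pi fun i => Measure.map (P i) (ρi i) := by
  have hm1 : Measurable (subgroupPiCoords H₂ : Subgroup.pi Set.univ H₂ → ∀ i, H₂ i) := (subgroupPiHomeomorph H₂).measurable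
  have hm2 : Measurable (subgroupPiCongr P : Subgroup.pi Set.univ H → Subgroup.pi Set.univ H₂) := (subgroupPiCongr P).continuous.measurable
  have hm3 : Measurable (subgroupPiCoords H : Subgroup.pi Set.univ H → ∀ i, H i) := (subgroupPiHomeomorph H).measurable
  have hm4 : Measurable (fun a : ∀ i, H i => fun i => P i (a i)) :=
    measurable_pi_lambda _ fun i => (P i).continuous.measurable.comp (measurable_pi_apply i)
  rw [Measure.map_map hm1 hm2]
  have hcomp : ((subgroupPiCoords H₂ : Subgroup.pi Set.univ H₂ → ∀ i, H₂ i) ∘ (subgroupPiCongr P)) =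
      (fun a : ∀ i, H i => fun i => P i (a i)) ∘ (subgroupPiCoords H) := rfl
  rw [hcomp, ← Measure.map_map hm4 hm3, hρp]
  haveI : ∀ i, SigmaFinite (Measure.map (P i) (ρi i)) := fun i => sigmaFinite_map_continuousMulEquiv (P i) (ρi i)
  exact (measurePreserving_pi ρi (fun i => Measure.map (P i) (ρi i)) fun i => ⟨(P i).continuous.measurable, rfl⟩).map_eq

variable {L L₂ M M₂ : Type*} [Group L] [Group L₂] [Group M] [Group M₂] [TopologicalSpace L] [TopologicalSpace L₂]
  [TopologicalSpace M] [TopologicalSpace M₂] [MeasurableSpace L] [MeasurableSpace L₂] [MeasurableSpace M] [MeasurableSpace M₂]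
  [BorelSpace L] [BorelSpace L₂] [BorelSpace M] [BorelSpace M₂] [SecondCountableTopology M] [SecondCountableTopology M₂]
  {HL : Subgroup L} {HL₂ : Subgroup L₂} {HM : Subgroup M} {HM₂ : Subgroup M₂}

/-- **The image of a product measure under `subgroupProdCongr P Q` is the product of the images**: if
`prodEquiv_* ρq = ρ₁ ⊗ ρ'` then `prodEquiv_* ((subgroupProdCongr P Q)_* ρq) = P_* ρ₁ ⊗ Q_* ρ'`. [folklore] -/
theorem map_prodEquiv_map_subgroupProdCongr (P : HL ≃ₜ* HL₂) (Q : HM ≃ₜ* HM₂) (ρ₁ : Measure HL) (ρ' : Measure HM)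
    [SFinite ρ₁] [SFinite ρ'] (ρq : Measure (HL.prod HM)) (hρq : Measure.map (Subgroup.prodEquiv HL HM) ρq = ρ₁.prod ρ') :
    Measure.map (Subgroup.prodEquiv HL₂ HM₂) (Measure.map (subgroupProdCongr P Q) ρq) =
      (Measure.map P ρ₁).prod (Measure.map Q ρ') := by
  have hm1 : Measurable (Subgroup.prodEquiv HL₂ HM₂ : HL₂.prod HM₂ → HL₂ × HM₂) :=
    (subgroupProdContinuousMulEquiv HL₂ HM₂).continuous.measurable
  have hm2 : Measurable (subgroupProdCongr P Q : HL.prod HM → HL₂.prod HM₂) := (subgroupProdCongr P Q).continuous.measurable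
  have hm3 : Measurable (Subgroup.prodEquiv HL HM : HL.prod HM → HL × HM) :=
    (subgroupProdContinuousMulEquiv HL HM).continuous.measurable
  have hm4 : Measurable (Prod.map P Q : HL × HM → HL₂ × HM₂) :=
    P.continuous.measurable.prodMap Q.continuous.measurable
  rw [Measure.map_map hm1 hm2]
  have hcomp : ((Subgroup.prodEquiv HL₂ HM₂ : HL₂.prod HM₂ → HL₂ × HM₂) ∘ (subgroupProdCongr P Q)) =
      (Prod.map P Q) ∘ (Subgroup.prodEquiv HL HM) := rfl
  rw [hcomp, ← Measure.map_map hm4 hm3, hρq]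
  exact (Measure.map_prod_map ρ₁ ρ' P.continuous.measurable Q.continuous.measurable).symm

end MapProd

/-! ### Transport of the product structure along a torus isomorphism -/

section Transport

variable {ι : Type*} [Fintype ι]
  -- side 1
  {G₁i : ι → Type*} [∀ i, Group (G₁i i)] [∀ i, TopologicalSpace (G₁i i)]
  [∀ i, MeasurableSpace (G₁i i)] [∀ i, BorelSpace (G₁i i)] [∀ i, SecondCountableTopology (G₁i i)]
  {G₁' : Type*} [Group G₁'] [TopologicalSpace G₁'] [MeasurableSpace G₁'] [BorelSpace G₁']
  [SecondCountableTopology G₁']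
  {G₁ : Type*} [Group G₁] [TopologicalSpace G₁] [MeasurableSpace G₁] [BorelSpace G₁]
  (e₁ : (∀ i, G₁i i) × G₁' ≃* G₁) {γ₁ : G₁} {γ₁i : ∀ i, G₁i i} {γ₁' : G₁'} (hγ₁ : e₁ (γ₁i, γ₁') = γ₁)
  -- side 2
  {G₂i : ι → Type*} [∀ i, Group (G₂i i)] [∀ i, TopologicalSpace (G₂i i)]
  [∀ i, MeasurableSpace (G₂i i)] [∀ i, BorelSpace (G₂i i)] [∀ i, SecondCountableTopology (G₂i i)]
  {G₂' : Type*} [Group G₂'] [TopologicalSpace G₂'] [MeasurableSpace G₂'] [BorelSpace G₂']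
  [SecondCountableTopology G₂']
  {G₂ : Type*} [Group G₂] [TopologicalSpace G₂] [MeasurableSpace G₂] [BorelSpace G₂]
  (e₂ : (∀ i, G₂i i) × G₂' ≃* G₂) (he₂ : Continuous e₂) (hes₂ : Continuous e₂.symm)
  {γ₂ : G₂} {γ₂i : ∀ i, G₂i i} {γ₂' : G₂'} (hγ₂ : e₂ (γ₂i, γ₂') = γ₂)
  -- the torus isomorphisms
  (Pi : ∀ i, Subgroup.centralizer ({γ₁i i} : Set (G₁i i)) ≃ₜ* Subgroup.centralizer ({γ₂i i} : Set (G₂i i)))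
  (P' : Subgroup.centralizer ({γ₁'} : Set G₁') ≃ₜ* Subgroup.centralizer ({γ₂'} : Set G₂'))
  (P : Subgroup.centralizer ({γ₁} : Set G₁) ≃ₜ* Subgroup.centralizer ({γ₂} : Set G₂))
  -- compatibility: `P` is `(Π Pᵢ) × P'` in the coordinates `e₁`, `e₂`
  (hPi : ∀ (x : Subgroup.centralizer ({γ₁} : Set G₁)) (i : ι)
    (hx : (e₁.symm (x : G₁)).1 i ∈ Subgroup.centralizer ({γ₁i i} : Set (G₁i i))),
    (e₂.symm ((P x : Subgroup.centralizer ({γ₂} : Set G₂)) : G₂)).1 i = (Pi i ⟨(e₁.symm (x : G₁)).1 i, hx⟩ : G₂i i))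
  (hP' : ∀ (x : Subgroup.centralizer ({γ₁} : Set G₁)) (hx : (e₁.symm (x : G₁)).2 ∈ Subgroup.centralizer ({γ₁'} : Set G₁')),
    (e₂.symm ((P x : Subgroup.centralizer ({γ₂} : Set G₂)) : G₂)).2 = (P' ⟨(e₁.symm (x : G₁)).2, hx⟩ : G₂'))
  -- side-1 torus measures in product form
  (ρ₁i : ∀ i, Measure (Subgroup.centralizer ({γ₁i i} : Set (G₁i i)))) [∀ i, SigmaFinite (ρ₁i i)]
  (ρ₁' : Measure (Subgroup.centralizer ({γ₁'} : Set G₁'))) [SFinite ρ₁']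
  (ρ₁p : Measure (Subgroup.pi Set.univ fun i => Subgroup.centralizer ({γ₁i i} : Set (G₁i i))))
  (hρ₁p : Measure.map (subgroupPiCoords fun i => Subgroup.centralizer ({γ₁i i} : Set (G₁i i))) ρ₁p = Measure.pi ρ₁i)
  (ρ₁₁ : Measure (Subgroup.centralizer ({γ₁i} : Set (∀ i, G₁i i)))) [SFinite ρ₁₁]
  (hρ₁₁ : ρ₁₁ = Measure.map (subgroupCongrHomeomorph (MulEquiv.refl (∀ i, G₁i i))
    (Subgroup.pi Set.univ fun i => Subgroup.centralizer ({γ₁i i} : Set (G₁i i))) (Subgroup.centralizer ({γ₁i} : Set (∀ i, G₁i i)))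
    (fun p => by rw [MulEquiv.refl_apply, centralizer_singleton_pi_eq]) continuous_id continuous_id) ρ₁p)
  (ρ₁q : Measure ((Subgroup.centralizer ({γ₁i} : Set (∀ i, G₁i i))).prod (Subgroup.centralizer ({γ₁'} : Set G₁'))))
  (hρ₁q : Measure.map (Subgroup.prodEquiv (Subgroup.centralizer ({γ₁i} : Set (∀ i, G₁i i))) (Subgroup.centralizer ({γ₁'} : Set G₁'))) ρ₁q =
    ρ₁₁.prod ρ₁')
  (ρ₁ : Measure (Subgroup.centralizer ({γ₁} : Set G₁)))
  (he₁ : Continuous e₁) (hes₁ : Continuous e₁.symm)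
  (hρ₁ : ρ₁ = Measure.map (subgroupCongrHomeomorph e₁ _ (Subgroup.centralizer ({γ₁} : Set G₁))
    (forall_apply_mem_centralizer_iff e₁ hγ₁) he₁ hes₁) ρ₁q)

omit [Fintype ι] [∀ i, TopologicalSpace (G₁i i)] [∀ i, MeasurableSpace (G₁i i)]
  [∀ i, BorelSpace (G₁i i)] [∀ i, SecondCountableTopology (G₁i i)] in
/-- Components of elements of the tuple centraliser `C((γᵢ))` lie in the `C(γᵢ)`. [folklore] -/
theorem apply_mem_centralizer_of_mem_centralizer_pi {t : ∀ i, G₁i i}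
    (ht : t ∈ Subgroup.centralizer ({γ₁i} : Set (∀ i, G₁i i))) (i : ι) :
    t i ∈ Subgroup.centralizer ({γ₁i i} : Set (G₁i i)) := by
  rw [centralizer_singleton_pi_eq] at ht
  exact ht i (Set.mem_univ i)

variable (γ₁i) in
omit [Fintype ι] [∀ i, MeasurableSpace (G₁i i)] [∀ i, BorelSpace (G₁i i)]
  [∀ i, SecondCountableTopology (G₁i i)] in
/-- **`C((γᵢ)) ≃ₜ* Π-subgroup of the C(γᵢ)`**: the identity, through `centralizer_singleton_pi_eq`. [folklore] -/
def tupleCentralizerEquivPi :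
    Subgroup.centralizer ({γ₁i} : Set (∀ i, G₁i i)) ≃ₜ* Subgroup.pi Set.univ fun i => Subgroup.centralizer ({γ₁i i} : Set (G₁i i)) :=
  { MulEquiv.subgroupCongr (centralizer_singleton_pi_eq (γ := γ₁i)) with
    continuous_toFun := continuous_subtype_val.subtype_mk _
    continuous_invFun := continuous_subtype_val.subtype_mk _ }

omit [Fintype ι] [∀ i, MeasurableSpace (G₁i i)] [∀ i, BorelSpace (G₁i i)]
  [∀ i, SecondCountableTopology (G₁i i)] in
/-- Underlying element of `tupleCentralizerEquivPi x` (definitional). [folklore] -/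
@[simp]
theorem coe_tupleCentralizerEquivPi (x : Subgroup.centralizer ({γ₁i} : Set (∀ i, G₁i i))) :
    ((tupleCentralizerEquivPi γ₁i x : Subgroup.pi Set.univ fun i => Subgroup.centralizer ({γ₁i i} : Set (G₁i i))) : ∀ i, G₁i i) =
      (x : ∀ i, G₁i i) := rfl

omit [Fintype ι] [∀ i, MeasurableSpace (G₁i i)] [∀ i, BorelSpace (G₁i i)]
  [∀ i, SecondCountableTopology (G₁i i)] in
/-- Underlying element of `(tupleCentralizerEquivPi)⁻¹ y` (definitional). [folklore] -/
@[simp]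
theorem coe_tupleCentralizerEquivPi_symm (y : Subgroup.pi Set.univ fun i => Subgroup.centralizer ({γ₁i i} : Set (G₁i i))) :
    (((tupleCentralizerEquivPi γ₁i).symm y : Subgroup.centralizer ({γ₁i} : Set (∀ i, G₁i i))) : ∀ i, G₁i i) = (y : ∀ i, G₁i i) := rfl

omit [Fintype ι] [∀ i, MeasurableSpace (G₁i i)] [∀ i, BorelSpace (G₁i i)]
  [∀ i, SecondCountableTopology (G₁i i)] [∀ i, MeasurableSpace (G₂i i)]
  [∀ i, BorelSpace (G₂i i)] [∀ i, SecondCountableTopology (G₂i i)] in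
/-- **The congruence of the tuple centralisers `C((γ₁ᵢ)) ≃ₜ* C((γ₂ᵢ))` induced by the `Pᵢ`** (through
`C((γᵢ)) = Π_i C(γᵢ)`). [folklore] -/
def tupleCentralizerCongr :
    Subgroup.centralizer ({γ₁i} : Set (∀ i, G₁i i)) ≃ₜ* Subgroup.centralizer ({γ₂i} : Set (∀ i, G₂i i)) :=
  ((tupleCentralizerEquivPi γ₁i).trans (subgroupPiCongr Pi)).trans (tupleCentralizerEquivPi γ₂i).symm

omit [Fintype ι] [∀ i, MeasurableSpace (G₁i i)] [∀ i, BorelSpace (G₁i i)]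
  [∀ i, SecondCountableTopology (G₁i i)] [∀ i, MeasurableSpace (G₂i i)]
  [∀ i, BorelSpace (G₂i i)] [∀ i, SecondCountableTopology (G₂i i)] in
/-- Components of `tupleCentralizerCongr Pᵢ x`: `(Pᵢ (xᵢ))_i`. [folklore] -/
theorem coe_tupleCentralizerCongr_apply (x : Subgroup.centralizer ({γ₁i} : Set (∀ i, G₁i i))) (i : ι) :
    ((tupleCentralizerCongr Pi x : Subgroup.centralizer ({γ₂i} : Set (∀ i, G₂i i))) : ∀ i, G₂i i) i =
      (Pi i ⟨(x : ∀ i, G₁i i) i, apply_mem_centralizer_of_mem_centralizer_pi x.2 i⟩ : G₂i i) := rfl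

include hPi hP' hρ₁p hρ₁₁ hρ₁q hρ₁ in
/-- **Transport of the product structure.** With the side-2 torus measures `ρ₂ᵢ = (Pᵢ)_* ρ₁ᵢ`,
`ρ₂' = P'_* ρ₁'`, `ρ₂ = P_* ρ₁` and the explicit product measures
`ρ₂p = (subgroupPiCongr Pᵢ)_* ρ₁p`, `ρ₂₁ = (tupleCentralizerCongr Pᵢ)_* ρ₁₁`,
`ρ₂q = (subgroupProdCongr (tupleCentralizerCongr Pᵢ) P')_* ρ₁q`, the four product hypotheses of
`InvariantQuotientOrbitalPiProdNormalized` hold on side `2`. [cite: Gelbart1975, p. 155] -/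
theorem torusMeasure_transport
    (ρ₂i : ∀ i, Measure (Subgroup.centralizer ({γ₂i i} : Set (G₂i i)))) (hρ₂i : ∀ i, ρ₂i i = Measure.map (Pi i) (ρ₁i i))
    (ρ₂' : Measure (Subgroup.centralizer ({γ₂'} : Set G₂'))) (hρ₂' : ρ₂' = Measure.map P' ρ₁')
    (ρ₂ : Measure (Subgroup.centralizer ({γ₂} : Set G₂))) (hρ₂ : ρ₂ = Measure.map P ρ₁) :
    Measure.map (subgroupPiCoords fun i => Subgroup.centralizer ({γ₂i i} : Set (G₂i i)))
        (Measure.map (subgroupPiCongr Pi) ρ₁p) = Measure.pi ρ₂i ∧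
      Measure.map (tupleCentralizerCongr Pi) ρ₁₁ =
        Measure.map (subgroupCongrHomeomorph (MulEquiv.refl (∀ i, G₂i i))
          (Subgroup.pi Set.univ fun i => Subgroup.centralizer ({γ₂i i} : Set (G₂i i))) (Subgroup.centralizer ({γ₂i} : Set (∀ i, G₂i i)))
          (fun p => by rw [MulEquiv.refl_apply, centralizer_singleton_pi_eq]) continuous_id continuous_id)
          (Measure.map (subgroupPiCongr Pi) ρ₁p) ∧
      Measure.map (Subgroup.prodEquiv (Subgroup.centralizer ({γ₂i} : Set (∀ i, G₂i i))) (Subgroup.centralizer ({γ₂'} : Set G₂')))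
          (Measure.map (subgroupProdCongr (tupleCentralizerCongr Pi) P') ρ₁q) =
        (Measure.map (tupleCentralizerCongr Pi) ρ₁₁).prod ρ₂' ∧
      ρ₂ = Measure.map (subgroupCongrHomeomorph e₂ _ (Subgroup.centralizer ({γ₂} : Set G₂))
          (forall_apply_mem_centralizer_iff e₂ hγ₂) he₂ hes₂) (Measure.map (subgroupProdCongr (tupleCentralizerCongr Pi) P') ρ₁q) := by
  refine ⟨?_, ?_, ?_, ?_⟩
  · -- coordinates of `ρ₂p`
    rw [map_subgroupPiCoords_map_subgroupPiCongr Pi ρ₁i ρ₁p hρ₁p]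
    congr 1
    funext i
    exact (hρ₂i i).symm
  · -- `ρ₂₁` versus `ρ₂p`: the two composites `C((γ₁ᵢ)) → C((γ₂ᵢ))` agree
    have hmT : Measurable (tupleCentralizerCongr Pi : Subgroup.centralizer ({γ₁i} : Set (∀ i, G₁i i)) →
        Subgroup.centralizer ({γ₂i} : Set (∀ i, G₂i i))) := (map_continuous _).measurable
    have hmC : Measurable (subgroupPiCongr Pi : (Subgroup.pi Set.univ fun i => Subgroup.centralizer ({γ₁i i} : Set (G₁i i))) →
        Subgroup.pi Set.univ fun i => Subgroup.centralizer ({γ₂i i} : Set (G₂i i))) := (map_continuous _).measurable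
    rw [hρ₁₁, Measure.map_map hmT (Homeomorph.measurable _), Measure.map_map (Homeomorph.measurable _) hmC]
    congr 1
  · -- the product `ρ₂q`
    rw [map_prodEquiv_map_subgroupProdCongr (tupleCentralizerCongr Pi) P' ρ₁₁ ρ₁' ρ₁q hρ₁q, hρ₂']
  · -- `ρ₂` versus `ρ₂q`: `P ∘ (congr e₁) = (congr e₂) ∘ (tupleCongr × P')` on `C((γ₁ᵢ)) × C(γ₁')`
    have hmP : Measurable (P : Subgroup.centralizer ({γ₁} : Set G₁) → Subgroup.centralizer ({γ₂} : Set G₂)) :=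
      (map_continuous _).measurable
    have hmQ : Measurable (subgroupProdCongr (tupleCentralizerCongr Pi) P' :
        (Subgroup.centralizer ({γ₁i} : Set (∀ i, G₁i i))).prod (Subgroup.centralizer ({γ₁'} : Set G₁')) →
          (Subgroup.centralizer ({γ₂i} : Set (∀ i, G₂i i))).prod (Subgroup.centralizer ({γ₂'} : Set G₂'))) :=
      (map_continuous _).measurable
    rw [hρ₂, hρ₁, Measure.map_map hmP (Homeomorph.measurable _), Measure.map_map (Homeomorph.measurable _) hmQ]
    congr 1
    funext y
    refine Subtype.ext ?_
    change (P (subgroupCongrHomeomorph e₁ _ _ (forall_apply_mem_centralizer_iff e₁ hγ₁) he₁ hes₁ y) : G₂) =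
      e₂ ((subgroupProdCongr (tupleCentralizerCongr Pi) P' y :
        (Subgroup.centralizer ({γ₂i} : Set (∀ i, G₂i i))).prod (Subgroup.centralizer ({γ₂'} : Set G₂'))) : (∀ i, G₂i i) × G₂')
    set x : Subgroup.centralizer ({γ₁} : Set G₁) := subgroupCongrHomeomorph e₁ _ _ (forall_apply_mem_centralizer_iff e₁ hγ₁) he₁ hes₁ y
      with hx
    have hxval : (x : G₁) = e₁ (y : (∀ i, G₁i i) × G₁') := rfl
    have hsymm : e₂.symm ((P x : Subgroup.centralizer ({γ₂} : Set G₂)) : G₂) =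
        ((subgroupProdCongr (tupleCentralizerCongr Pi) P' y :
          (Subgroup.centralizer ({γ₂i} : Set (∀ i, G₂i i))).prod (Subgroup.centralizer ({γ₂'} : Set G₂'))) : (∀ i, G₂i i) × G₂') := by
      have hy : e₁.symm (x : G₁) = (y : (∀ i, G₁i i) × G₁') := by rw [hxval, MulEquiv.symm_apply_apply]
      have hy1 : ∀ i, (e₁.symm (x : G₁)).1 i ∈ Subgroup.centralizer ({γ₁i i} : Set (G₁i i)) := fun i => by
        rw [hy]; exact apply_mem_centralizer_of_mem_centralizer_pi y.2.1 i
      have hy2 : (e₁.symm (x : G₁)).2 ∈ Subgroup.centralizer ({γ₁'} : Set G₁') := by rw [hy]; exact y.2.2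
      have h1 : ∀ i, (⟨(e₁.symm (x : G₁)).1 i, hy1 i⟩ : Subgroup.centralizer ({γ₁i i} : Set (G₁i i))) =
          ⟨((Subgroup.prodEquiv _ _ y).1 : ∀ i, G₁i i) i,
            apply_mem_centralizer_of_mem_centralizer_pi (Subgroup.prodEquiv _ _ y).1.2 i⟩ := fun i =>
        Subtype.ext (by change (e₁.symm (x : G₁)).1 i = _; rw [hy]; rfl)
      have h2 : (⟨(e₁.symm (x : G₁)).2, hy2⟩ : Subgroup.centralizer ({γ₁'} : Set G₁')) = (Subgroup.prodEquiv _ _ y).2 :=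
        Subtype.ext (by change (e₁.symm (x : G₁)).2 = _; rw [hy]; rfl)
      refine Prod.ext (funext fun i => ?_) ?_
      · rw [hPi x i (hy1 i), h1 i, coe_subgroupProdCongr_apply]
        rfl
      · rw [hP' x hy2, h2, coe_subgroupProdCongr_apply]
    rw [← hsymm, MulEquiv.apply_symm_apply]

end Transport

/-! ### Gelbart's (10.19) on side 2 for the transported torus measures -/

section Factorization

variable {ι : Type*} [Fintype ι]
  -- side 1
  {G₁i : ι → Type*} [∀ i, Group (G₁i i)] [∀ i, TopologicalSpace (G₁i i)]
  [∀ i, IsTopologicalGroup (G₁i i)] [∀ i, MeasurableSpace (G₁i i)] [∀ i, BorelSpace (G₁i i)] [∀ i, SecondCountableTopology (G₁i i)]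
  {G₁' : Type*} [Group G₁'] [TopologicalSpace G₁'] [IsTopologicalGroup G₁'] [MeasurableSpace G₁'] [BorelSpace G₁']
  [SecondCountableTopology G₁']
  {G₁ : Type*} [Group G₁] [TopologicalSpace G₁] [MeasurableSpace G₁] [BorelSpace G₁]
  (e₁ : (∀ i, G₁i i) × G₁' ≃* G₁) (he₁ : Continuous e₁) (hes₁ : Continuous e₁.symm)
  {γ₁ : G₁} {γ₁i : ∀ i, G₁i i} {γ₁' : G₁'} (hγ₁ : e₁ (γ₁i, γ₁') = γ₁)
  -- side 2
  {G₂i : ι → Type*} [∀ i, Group (G₂i i)] [∀ i, TopologicalSpace (G₂i i)]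
  [∀ i, IsTopologicalGroup (G₂i i)] [∀ i, LocallyCompactSpace (G₂i i)] [∀ i, SecondCountableTopology (G₂i i)]
  [∀ i, T2Space (G₂i i)] [∀ i, MeasurableSpace (G₂i i)] [∀ i, BorelSpace (G₂i i)]
  {G₂' : Type*} [Group G₂'] [TopologicalSpace G₂'] [IsTopologicalGroup G₂'] [LocallyCompactSpace G₂']
  [SecondCountableTopology G₂'] [T2Space G₂'] [MeasurableSpace G₂'] [BorelSpace G₂']
  {G₂ : Type*} [Group G₂] [TopologicalSpace G₂] [IsTopologicalGroup G₂] [LocallyCompactSpace G₂]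
  [SecondCountableTopology G₂] [T2Space G₂] [MeasurableSpace G₂] [BorelSpace G₂]
  (e₂ : (∀ i, G₂i i) × G₂' ≃* G₂) (he₂ : Continuous e₂) (hes₂ : Continuous e₂.symm)
  {γ₂ : G₂} {γ₂i : ∀ i, G₂i i} {γ₂' : G₂'} (hγ₂ : e₂ (γ₂i, γ₂') = γ₂)
  (hC : IsClosed ((Subgroup.centralizer ({γ₂} : Set G₂) : Subgroup G₂) : Set G₂))
  (hCi : ∀ i, IsClosed ((Subgroup.centralizer ({γ₂i i} : Set (G₂i i)) : Subgroup (G₂i i)) : Set (G₂i i)))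
  (hC' : IsClosed ((Subgroup.centralizer ({γ₂'} : Set G₂') : Subgroup G₂') : Set G₂'))
  [MeasurableSpace (G₂ ⧸ Subgroup.centralizer ({γ₂} : Set G₂))] [BorelSpace (G₂ ⧸ Subgroup.centralizer ({γ₂} : Set G₂))]
  [∀ i, MeasurableSpace (G₂i i ⧸ Subgroup.centralizer ({γ₂i i} : Set (G₂i i)))]
  [∀ i, BorelSpace (G₂i i ⧸ Subgroup.centralizer ({γ₂i i} : Set (G₂i i)))]
  [MeasurableSpace (G₂' ⧸ Subgroup.centralizer ({γ₂'} : Set G₂'))] [BorelSpace (G₂' ⧸ Subgroup.centralizer ({γ₂'} : Set G₂'))]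
  -- the torus isomorphisms
  (Pi : ∀ i, Subgroup.centralizer ({γ₁i i} : Set (G₁i i)) ≃ₜ* Subgroup.centralizer ({γ₂i i} : Set (G₂i i)))
  (P' : Subgroup.centralizer ({γ₁'} : Set G₁') ≃ₜ* Subgroup.centralizer ({γ₂'} : Set G₂'))
  (P : Subgroup.centralizer ({γ₁} : Set G₁) ≃ₜ* Subgroup.centralizer ({γ₂} : Set G₂))
  (hPi : ∀ (x : Subgroup.centralizer ({γ₁} : Set G₁)) (i : ι)
    (hx : (e₁.symm (x : G₁)).1 i ∈ Subgroup.centralizer ({γ₁i i} : Set (G₁i i))),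
    (e₂.symm ((P x : Subgroup.centralizer ({γ₂} : Set G₂)) : G₂)).1 i = (Pi i ⟨(e₁.symm (x : G₁)).1 i, hx⟩ : G₂i i))
  (hP' : ∀ (x : Subgroup.centralizer ({γ₁} : Set G₁)) (hx : (e₁.symm (x : G₁)).2 ∈ Subgroup.centralizer ({γ₁'} : Set G₁')),
    (e₂.symm ((P x : Subgroup.centralizer ({γ₂} : Set G₂)) : G₂)).2 = (P' ⟨(e₁.symm (x : G₁)).2, hx⟩ : G₂'))
  -- side-1 torus measures in product form
  (ρ₁i : ∀ i, Measure (Subgroup.centralizer ({γ₁i i} : Set (G₁i i)))) [∀ i, SigmaFinite (ρ₁i i)]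
  (ρ₁' : Measure (Subgroup.centralizer ({γ₁'} : Set G₁'))) [SFinite ρ₁']
  (ρ₁p : Measure (Subgroup.pi Set.univ fun i => Subgroup.centralizer ({γ₁i i} : Set (G₁i i))))
  [ρ₁p.IsMulLeftInvariant] [IsFiniteMeasureOnCompacts ρ₁p] [ρ₁p.IsOpenPosMeasure] [ρ₁p.IsInvInvariant] [SFinite ρ₁p]
  (hρ₁p : Measure.map (subgroupPiCoords fun i => Subgroup.centralizer ({γ₁i i} : Set (G₁i i))) ρ₁p = Measure.pi ρ₁i)
  (ρ₁₁ : Measure (Subgroup.centralizer ({γ₁i} : Set (∀ i, G₁i i))))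
  [ρ₁₁.IsMulLeftInvariant] [IsFiniteMeasureOnCompacts ρ₁₁] [ρ₁₁.IsOpenPosMeasure] [ρ₁₁.IsInvInvariant] [SFinite ρ₁₁]
  (hρ₁₁ : ρ₁₁ = Measure.map (subgroupCongrHomeomorph (MulEquiv.refl (∀ i, G₁i i))
    (Subgroup.pi Set.univ fun i => Subgroup.centralizer ({γ₁i i} : Set (G₁i i))) (Subgroup.centralizer ({γ₁i} : Set (∀ i, G₁i i)))
    (fun p => by rw [MulEquiv.refl_apply, centralizer_singleton_pi_eq]) continuous_id continuous_id) ρ₁p)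
  (ρ₁q : Measure ((Subgroup.centralizer ({γ₁i} : Set (∀ i, G₁i i))).prod (Subgroup.centralizer ({γ₁'} : Set G₁'))))
  [ρ₁q.IsMulLeftInvariant] [IsFiniteMeasureOnCompacts ρ₁q] [ρ₁q.IsOpenPosMeasure] [ρ₁q.IsInvInvariant] [SFinite ρ₁q]
  (hρ₁q : Measure.map (Subgroup.prodEquiv (Subgroup.centralizer ({γ₁i} : Set (∀ i, G₁i i))) (Subgroup.centralizer ({γ₁'} : Set G₁'))) ρ₁q =
    ρ₁₁.prod ρ₁')
  (ρ₁ : Measure (Subgroup.centralizer ({γ₁} : Set G₁)))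
  (hρ₁ : ρ₁ = Measure.map (subgroupCongrHomeomorph e₁ _ (Subgroup.centralizer ({γ₁} : Set G₁))
    (forall_apply_mem_centralizer_iff e₁ hγ₁) he₁ hes₁) ρ₁q)
  -- side-2 torus measures, transported
  (ρ₂i : ∀ i, Measure (Subgroup.centralizer ({γ₂i i} : Set (G₂i i)))) [∀ i, (ρ₂i i).IsMulLeftInvariant]
  [∀ i, IsFiniteMeasureOnCompacts (ρ₂i i)] [∀ i, (ρ₂i i).IsOpenPosMeasure] [∀ i, (ρ₂i i).IsInvInvariant]
  [∀ i, SigmaFinite (ρ₂i i)] (hρ₂i : ∀ i, ρ₂i i = Measure.map (Pi i) (ρ₁i i))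
  (ρ₂' : Measure (Subgroup.centralizer ({γ₂'} : Set G₂'))) [ρ₂'.IsMulLeftInvariant] [IsFiniteMeasureOnCompacts ρ₂']
  [ρ₂'.IsOpenPosMeasure] [ρ₂'.IsInvInvariant] [SFinite ρ₂'] (hρ₂' : ρ₂' = Measure.map P' ρ₁')
  (ρ₂ : Measure (Subgroup.centralizer ({γ₂} : Set G₂))) [ρ₂.IsMulLeftInvariant] [IsFiniteMeasureOnCompacts ρ₂]
  [ρ₂.IsOpenPosMeasure] [ρ₂.IsInvInvariant] [SFinite ρ₂] (hρ₂ : ρ₂ = Measure.map P ρ₁)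
  -- Haar measures on the side-2 groups
  (νi : ∀ i, Measure (G₂i i)) [∀ i, IsHaarMeasure (νi i)] [∀ i, (νi i).IsMulRightInvariant]
  (ν' : Measure G₂') [IsHaarMeasure ν'] [ν'.IsMulRightInvariant]
  (ν : Measure G₂) [IsHaarMeasure ν] [ν.IsMulRightInvariant] (hν : ν = Measure.map e₂ ((Measure.pi νi).prod ν'))

include he₂ hes₂ hγ₂ hPi hP' hρ₁p hρ₁₁ hρ₁q hρ₁ hρ₂i hρ₂' hρ₂ hν in
/-- **Gelbart's (10.19) with its equality sign on side `2`, for torus measures transported from side `1`**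
(`[0, ∞]`-valued form): for measurable `Φ, ξ_i, Θ ≥ 0` with `Φ(e₂((a_i), k)) = (Π_i ξ_i(a_i)) Θ(k)`,
`∫⁻_{G₂/C(γ₂)} Φ d(ν / P_*ρ₁) = (Π_i ∫⁻_{G₂ᵢ/C(γ₂ᵢ)} ξ_i d(ν_i / (Pᵢ)_*ρ₁ᵢ)) ∫⁻_{G₂'/C(γ₂')} Θ d(ν' / P'_*ρ₁')`.
[cite: Gelbart1975, p. 155 (10.19)] -/
theorem lintegral_descConj_quotientMeasure_eq_prod_mul_of_torusEquiv
    {Φ : G₂ → ℝ≥0∞} {ξ : ∀ i, G₂i i → ℝ≥0∞} {Θ : G₂' → ℝ≥0∞} (hΦ : Measurable Φ) (hξ : ∀ i, Measurable (ξ i))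
    (hΘ : Measurable Θ) (hΦe : ∀ (a : ∀ i, G₂i i) (k : G₂'), Φ (e₂ (a, k)) = (∏ i, ξ i (a i)) * Θ k) :
    ∫⁻ y, descConj γ₂ (Subgroup.centralizer ({γ₂} : Set G₂)) (centralizer_comm γ₂) Φ y
        ∂quotientMeasure (Subgroup.centralizer ({γ₂} : Set G₂)) ρ₂ hC ν =
      (∏ i, ∫⁻ x, descConj (γ₂i i) _ (centralizer_comm _) (ξ i) x ∂quotientMeasure _ (ρ₂i i) (hCi i) (νi i)) *
        ∫⁻ x, descConj γ₂' _ (centralizer_comm _) Θ x ∂quotientMeasure _ ρ₂' hC' ν' := by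
  obtain ⟨h₂p, h₂₁, h₂q, h₂⟩ := torusMeasure_transport e₁ hγ₁ e₂ he₂ hes₂ hγ₂ Pi P' P hPi hP' ρ₁i ρ₁' ρ₁p hρ₁p ρ₁₁ hρ₁₁ ρ₁q hρ₁q ρ₁
    he₁ hes₁ hρ₁ ρ₂i hρ₂i ρ₂' hρ₂' ρ₂ hρ₂
  -- Haar-type instances for the transported product measures
  haveI := isMulLeftInvariant_map_continuousMulEquiv (subgroupPiCongr Pi) ρ₁p
  haveI := isFiniteMeasureOnCompacts_map_continuousMulEquiv (subgroupPiCongr Pi) ρ₁p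
  haveI := isOpenPosMeasure_map_continuousMulEquiv (subgroupPiCongr Pi) ρ₁p
  haveI := isInvInvariant_map_continuousMulEquiv (subgroupPiCongr Pi) ρ₁p
  haveI := isMulLeftInvariant_map_continuousMulEquiv (tupleCentralizerCongr Pi) ρ₁₁
  haveI := isFiniteMeasureOnCompacts_map_continuousMulEquiv (tupleCentralizerCongr Pi) ρ₁₁
  haveI := isOpenPosMeasure_map_continuousMulEquiv (tupleCentralizerCongr Pi) ρ₁₁
  haveI := isInvInvariant_map_continuousMulEquiv (tupleCentralizerCongr Pi) ρ₁₁
  haveI := isMulLeftInvariant_map_continuousMulEquiv (subgroupProdCongr (tupleCentralizerCongr Pi) P') ρ₁q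
  haveI := isFiniteMeasureOnCompacts_map_continuousMulEquiv (subgroupProdCongr (tupleCentralizerCongr Pi) P') ρ₁q
  haveI := isOpenPosMeasure_map_continuousMulEquiv (subgroupProdCongr (tupleCentralizerCongr Pi) P') ρ₁q
  haveI := isInvInvariant_map_continuousMulEquiv (subgroupProdCongr (tupleCentralizerCongr Pi) P') ρ₁q
  exact lintegral_descConj_quotientMeasure_eq_prod_mul e₂ he₂ hes₂ hγ₂ hC hCi hC' ρ₂i ρ₂' _ h₂p _ h₂₁ _ h₂q ρ₂ h₂ νi ν' ν hν
    hΦ hξ hΘ hΦe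

include he₂ hes₂ hγ₂ hPi hP' hρ₁p hρ₁₁ hρ₁q hρ₁ hρ₂i hρ₂' hρ₂ hν in
/-- **Gelbart's (10.19) with its equality sign on side `2`, for torus measures transported from side `1`**
(complex-valued form). [cite: Gelbart1975, p. 155 (10.19)] -/
theorem integral_descConj_quotientMeasure_eq_prod_mul_of_torusEquiv (Φ : G₂ → ℂ) (ξ : ∀ i, G₂i i → ℂ) (Θ : G₂' → ℂ)
    (hΦe : ∀ (a : ∀ i, G₂i i) (k : G₂'), Φ (e₂ (a, k)) = (∏ i, ξ i (a i)) * Θ k) :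
    ∫ y, descConj γ₂ (Subgroup.centralizer ({γ₂} : Set G₂)) (centralizer_comm γ₂) Φ y
        ∂quotientMeasure (Subgroup.centralizer ({γ₂} : Set G₂)) ρ₂ hC ν =
      (∏ i, ∫ x, descConj (γ₂i i) _ (centralizer_comm _) (ξ i) x ∂quotientMeasure _ (ρ₂i i) (hCi i) (νi i)) *
        ∫ x, descConj γ₂' _ (centralizer_comm _) Θ x ∂quotientMeasure _ ρ₂' hC' ν' := by
  obtain ⟨h₂p, h₂₁, h₂q, h₂⟩ := torusMeasure_transport e₁ hγ₁ e₂ he₂ hes₂ hγ₂ Pi P' P hPi hP' ρ₁i ρ₁' ρ₁p hρ₁p ρ₁₁ hρ₁₁ ρ₁q hρ₁q ρ₁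
    he₁ hes₁ hρ₁ ρ₂i hρ₂i ρ₂' hρ₂' ρ₂ hρ₂
  haveI := isMulLeftInvariant_map_continuousMulEquiv (subgroupPiCongr Pi) ρ₁p
  haveI := isFiniteMeasureOnCompacts_map_continuousMulEquiv (subgroupPiCongr Pi) ρ₁p
  haveI := isOpenPosMeasure_map_continuousMulEquiv (subgroupPiCongr Pi) ρ₁p
  haveI := isInvInvariant_map_continuousMulEquiv (subgroupPiCongr Pi) ρ₁p
  haveI := isMulLeftInvariant_map_continuousMulEquiv (tupleCentralizerCongr Pi) ρ₁₁
  haveI := isFiniteMeasureOnCompacts_map_continuousMulEquiv (tupleCentralizerCongr Pi) ρ₁₁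
  haveI := isOpenPosMeasure_map_continuousMulEquiv (tupleCentralizerCongr Pi) ρ₁₁
  haveI := isInvInvariant_map_continuousMulEquiv (tupleCentralizerCongr Pi) ρ₁₁
  haveI := isMulLeftInvariant_map_continuousMulEquiv (subgroupProdCongr (tupleCentralizerCongr Pi) P') ρ₁q
  haveI := isFiniteMeasureOnCompacts_map_continuousMulEquiv (subgroupProdCongr (tupleCentralizerCongr Pi) P') ρ₁q
  haveI := isOpenPosMeasure_map_continuousMulEquiv (subgroupProdCongr (tupleCentralizerCongr Pi) P') ρ₁q
  haveI := isInvInvariant_map_continuousMulEquiv (subgroupProdCongr (tupleCentralizerCongr Pi) P') ρ₁q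
  exact integral_descConj_quotientMeasure_eq_prod_mul e₂ he₂ hes₂ hγ₂ hC hCi hC' ρ₂i ρ₂' _ h₂p _ h₂₁ _ h₂q ρ₂ h₂ νi ν' ν hν Φ ξ Θ hΦe

end Factorization

end Literature.MeasureTheory.Group
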